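/-
HONEST FRAMING: certified error envelopes and provably optimal rounding/accumulation schemes for
low-precision formats under stated cost models; every table by two implementations; no hardware
or vendor claims.
-/
import Summits.Ventures.CertifiedArithmetic.LowPrec.OptTreePairwise

/-!
# Tree polynomial law, part 4: sequential summation is the worst tree

Cost model CM-T over a full binary format (OPTIMA.md §T, Theorem T4(d)).  Parts 1–3 showed that
the exact worst-case relative under-estimation of a summation tree `t` on nonnegative data under
ties-to-even is `1 - 1/M_t(u)` and that pairwise summation MINIMISES `M_t(u)` (value `B_n(u)`).
Here: the MAXIMUM of `M_t(u)` over all trees with `n` leaves is `1 + (n-1)·u`, attained by the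
sequential (recursive) tree — so the literature's any-order constant `(n-1)u/(1+(n-1)u)` is the
worst case of the sequential shape, and no shape is worse.  `treeM_le_sequential` (every tree, `0 ≤ u ≤ 1`), `treeM_seqTree` (attainment),
`R4_SequentialMaximisesTreePolynomial` (+ `_holds`).
-/

namespace Summit.Ventures.CertifiedArithmetic.LowPrec.Opt

open Literature.ComputerArithmetic.JeannerodRump2018
open Literature.ComputerArithmetic.JeannerodRump2018.SumTree

/-- EVERY TREE: `M_t(u) ≤ 1 + (n - 1)·u` (`n` = number of leaves, `0 ≤ u ≤ 1`).  At a node with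
`a + b` leaves: `max + u·min ≤ (1 + (b-1)u) + u(1 + (a-1)u) ≤ 1 + (a+b-1)u` since `u² ≤ u`. -/
theorem treeM_le_sequential {u : ℚ} (hu0 : 0 ≤ u) (hu1 : u ≤ 1) :
    ∀ t : SumTree, treeM u t ≤ 1 + (((leaves t).length : ℚ) - 1) * u
  | .leaf x => by simp [leaves]
  | .node l r => by
      have hl := treeM_le_sequential hu0 hu1 l
      have hr := treeM_le_sequential hu0 hu1 r
      have h1l := one_le_treeM hu0 l
      have h1r := one_le_treeM hu0 r
      have hal : (1 : ℚ) ≤ (leaves l).length := by exact_mod_cast one_le_length_leaves l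
      have har : (1 : ℚ) ≤ (leaves r).length := by exact_mod_cast one_le_length_leaves r
      simp only [treeM_node, leaves, List.length_append, Nat.cast_add]
      have huu : u * u ≤ u := by nlinarith
      rcases le_total (treeM u l) (treeM u r) with h | h
      · rw [max_eq_right h, min_eq_left h]
        have h2 : u * treeM u l ≤ u * (1 + (((leaves l).length : ℚ) - 1) * u) :=
          mul_le_mul_of_nonneg_left hl hu0
        nlinarith [mul_le_mul_of_nonneg_left huu (by linarith : (0 : ℚ) ≤ ((leaves l).length : ℚ) - 1)]
      · rw [max_eq_left h, min_eq_right h]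
        have h2 : u * treeM u r ≤ u * (1 + (((leaves r).length : ℚ) - 1) * u) :=
          mul_le_mul_of_nonneg_left hr hu0
        nlinarith [mul_le_mul_of_nonneg_left huu (by linarith : (0 : ℚ) ≤ ((leaves r).length : ℚ) - 1)]

/-- The sequential (recursive, left-deep) summation tree on `n` leaves (`n ≥ 1`; `seqTree 0` is a
single leaf by convention):  `(((x₁ + x₂) + x₃) + ⋯) + x_n`. -/
def seqTree : ℕ → SumTree
  | 0 => .leaf 0
  | 1 => .leaf 0
  | n + 2 => .node (seqTree (n + 1)) (.leaf 0)

/-- `seqTree n` has `n` leaves (`n ≥ 1`). -/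
theorem length_leaves_seqTree : ∀ n : ℕ, 1 ≤ n → (leaves (seqTree n)).length = n
  | 0, h => by omega
  | 1, _ => by simp [seqTree, leaves]
  | n + 2, _ => by
      have := length_leaves_seqTree (n + 1) (by omega)
      simp [seqTree, leaves, List.length_append, this]

/-- ATTAINMENT: `M(seqTree n)(u) = 1 + (n-1)·u` for `n ≥ 1` and `u ≥ 0`. -/
theorem treeM_seqTree {u : ℚ} (hu0 : 0 ≤ u) : ∀ n : ℕ, 1 ≤ n → treeM u (seqTree n) = 1 + ((n : ℚ) - 1) * u
  | 0, h => by omega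
  | 1, _ => by simp [seqTree]
  | n + 2, _ => by
      have ih := treeM_seqTree hu0 (n + 1) (by omega)
      simp only [seqTree, treeM_node, treeM_leaf, ih]
      have h1 : (1 : ℚ) ≤ 1 + (((n + 1 : ℕ) : ℚ) - 1) * u := by
        have : (0 : ℚ) ≤ (((n + 1 : ℕ) : ℚ) - 1) := by
          have hn : (0 : ℚ) ≤ (n : ℚ) := Nat.cast_nonneg n
          push_cast; linarith
        nlinarith
      rw [max_eq_left h1, min_eq_right h1]
      push_cast; ring

/-- RUNG (CM-T, OPTIMA.md Theorem T4(d)): SEQUENTIAL SUMMATION IS THE WORST TREE.  For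
`0 ≤ u ≤ 1`, every summation tree with `n` leaves has tree polynomial `M_t(u) ≤ 1 + (n-1)u`, and the
sequential tree attains this value; with parts 1–3, under ties-to-even on nonnegative data the
worst-case relative under-estimation of any tree is at most `(n-1)u/(1 + (n-1)u)` — the any-order
constant of the literature — with equality for the sequential shape. -/
def R4_SequentialMaximisesTreePolynomial : Prop :=
  ∀ u : ℚ, 0 ≤ u → u ≤ 1 →
    (∀ t : SumTree, treeM u t ≤ 1 + (((leaves t).length : ℚ) - 1) * u) ∧
    (∀ n : ℕ, 1 ≤ n →
      treeM u (seqTree n) = 1 + ((n : ℚ) - 1) * u ∧ (leaves (seqTree n)).length = n)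

/-- `R4_SequentialMaximisesTreePolynomial` holds. -/
theorem R4_SequentialMaximisesTreePolynomial_holds : R4_SequentialMaximisesTreePolynomial :=
  fun _u hu0 hu1 => ⟨treeM_le_sequential hu0 hu1,
    fun n hn => ⟨treeM_seqTree hu0 n hn, length_leaves_seqTree n hn⟩⟩

end Summit.Ventures.CertifiedArithmetic.LowPrec.Opt
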